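import Summits.BirchSwinnertonDyer.Rank1Residual.GaloisImage.FiniteSingularComparisonInjective
import Summits.BirchSwinnertonDyer.Rank1Residual.GaloisImage.KolyvaginPrimeLocalShapeRatHolds
import Literature.NumberTheory.EllipticCurves.OrdinaryReductionTorsionLineProofs
import HarnessLib

/-!
# The canonical finite–singular comparison map is an isomorphism, IV: ADMISSIBILITY of the
# canonical Kolyvagin datum at Sakamoto's primes over `ℚ` ([MR04] Lemma 1.2.3 = Rubin Ex. 1.9.7)
# (cell `b2b-bsdres`, team n1011, seat p11 gen 4, OWNERS row T-HCC-adm; file 4/5 — MAIN)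

HONEST FRAMING (cell `b2b-bsdres`, run/shared/lean/b2b/bsd-rank1-residual/, verbatim in every
file): the goal of the cell is to DELETE the COMBINATION-SHAPED residual classes of the
Birch–Swinnerton-Dyer formula for ALL analytic-rank `≤ 1` elliptic curves over `ℚ` — "full BSD
formula for every rank `≤ 1` curve in class `C`" assembled STRICTLY from published theorems — so
that the rank-`≤ 1` remainder becomes exactly the CONSTRUCTION-SHAPED classes, which are TYPED
(missing-input `Prop`s), NOT attempted. This is not "finishing BSD". Team n1011 (N10 / N11, the
additive block X4 ∧ `p = 3`): research route on the CONSTRUCTION-SHAPED class X4; no claim beyond the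
stated classes; nothing is booked. TOOL theorems of Galois cohomology; no definition, no named fact,
no `sorry`.

## What is proved

For a discrete `Γ_ℚ`-module `T` free of finite rank over `𝔽_p` (`p` a prime), `τ ∈ Gal(ℚ̄/ℚ(μ_p))`
with `T/(τ − 1)T ≅ ℤ/p` (Sakamoto's (H.2)), and a Kolyvagin datum `D` on `T` whose primes are
Sakamoto's `τ`-class primes `𝒫(τ) = frobeniusClassPrimes ρ S τ p` and whose comparison maps are THE
CANONICAL ones (`D.HasCanonicalComparison p η`, n1011-lit's predicate; such `D` EXIST by n1011-p04's
`FSComp.exists_kolyvaginDatum_hasCanonicalComparison_frobeniusClassPrimes`):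

* **`FSComp.isAdmissible_of_hasCanonicalComparison_frobeniusClassPrimes : D.IsAdmissible`** — at
  every `𝔮 ∈ 𝒫(τ)` the map `φ^{fs}_𝔮` is a BIJECTION `H¹_ur(ℚ_𝔮, T) ⥲ H¹(ℚ_𝔮, T)/H¹_ur` (Mazur–Rubin,
  *Kolyvagin systems*, Lemma 1.2.3; Rubin PCMI Ex. 1.9.7 — the property the tree's
  `KolyvaginDatum.IsAdmissible` records and which the vendored vocabulary left as "a theorem not
  claimed here", `FiniteSingularComparison.lean`).  INJECTIVITY is file 3 (a local arithmetic
  Frobenius acts on `T` as a conjugate of `τ`, n1011-p04 `exists_toLocal_eq_conj`, so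
  `T/(Fr_𝔮 − 1)T ≅ ℤ/p`; an inertia element over Kim's primitive root `η_𝔮` exists by n1011-lit's
  `Rat.exists_mem_absInertia_…` through n1011-p18's `_holds`); SURJECTIVITY by counting with
  n1011-p18's landed ℚ-readings `#H¹_ur = p`, `#H¹_tr = p`, `H¹_ur + H¹_tr = H¹` at the primes of
  `𝒫(τ)` (Rubin Prop. 1.4.13 (1), 1.9.5 (1), (3)): `#(H¹/H¹_ur) ≤ #H¹_tr = p = #H¹_ur`.
* `FSComp.exists_kolyvaginDatum_isAdmissible_frobeniusClassPrimes` — p04's existence theorem with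
  admissibility added: `∃ D, D.primes = 𝒫(τ) ∧ D.transverse = 𝒯 ∧ D.HasCanonicalComparison p η ∧
  D.IsAdmissible`.

Scope (stated, not widened): prime modulus `p` (the modulus of R1-16 / `E[p]`); the prime-power
modulus of [MR04] 1.2.3 (Nakayama) and general number fields (the tree's `frobeniusClassPrimes` /
`cyclotomicTransverse` are the printed objects for `K = ℚ` only) are not treated.

References: B. Mazur, K. Rubin, Mem. AMS 799 (2004), Lemma 1.2.1, Def. 1.2.2, Lemma 1.2.3, 1.2.4
(pp. 10–11); K. Rubin, PCMI 18 (2011), Prop. 1.4.13, 1.9.5, Def. 1.9.6, Ex. 1.9.7; R. Sakamoto,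
JTNB 36 (2024) §2, §4; C.-H. Kim, AJM 148 §2.2.2; J.-P. Serre, *Local Fields* IV §4 Prop. 17–18.
-/

noncomputable section

open Field Polynomial Module NumberField IsDedekindDomain
open Literature.NumberTheory.GaloisRepresentations
open Literature.NumberTheory.GaloisRepresentations.DiscreteGaloisModule
open Literature.NumberTheory.GaloisCohomology
open scoped ContRepresentation Polynomial NumberField

namespace Summit.BirchSwinnertonDyer.Rank1Residual.GaloisImage.FSComp

/-! ### §1 Transport of `T/(σ − 1)T` along a conjugation -/

section Conj

universe u

variable {F : Type u} [Field F] {M : Type u} [AddCommGroup M] [TopologicalSpace M]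
  [DiscreteTopology M]

/-- **`coker (g τ g⁻¹ − 1) ≃ coker (τ − 1)`**: if an endomorphism `f = ρ' φ` of `M` (for a second
action `ρ'` on the same group, e.g. the local action) equals `ρ g ∘ ρ τ ∘ ρ g⁻¹`, then `ρ g`
carries `(τ − 1)M` onto `(f − 1)M`, so `M/(f − 1)M ≃+ M/(τ − 1)M`; in particular
`T/(Fr_𝔮 − 1)T ≅ ℤ/N` at Sakamoto's primes follows from (H.2) `T/(τ − 1)T ≅ ℤ/N`. [folklore] -/
theorem nonempty_cokerSubOne_equiv_of_eq_conj {F' : Type u} [Field F']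
    (ρ : DiscreteGaloisModule F M) (ρ' : DiscreteGaloisModule F' M)
    {φ : absoluteGaloisGroup F'} {τ g : absoluteGaloisGroup F} (h : ρ' φ = ρ g * ρ τ * ρ g⁻¹)
    {N : ℕ} (hτ : Nonempty (cokerSubOne ρ τ ≃+ ZMod N)) :
    Nonempty (cokerSubOne ρ' φ ≃+ ZMod N) := by
  obtain ⟨eτ⟩ := hτ
  have hgi : ∀ m, ρ g⁻¹ (ρ g m) = m := fun m => by
    rw [← Module.End.mul_apply, ← map_mul, inv_mul_cancel, map_one, Module.End.one_apply]
  have hig : ∀ m, ρ g (ρ g⁻¹ m) = m := fun m => by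
    rw [← Module.End.mul_apply, ← map_mul, mul_inv_cancel, map_one, Module.End.one_apply]
  let e : M ≃+ M :=
    { toFun := ρ g
      invFun := ρ g⁻¹
      left_inv := hgi
      right_inv := hig
      map_add' := fun a b => map_add _ a b }
  have he : ∀ m, e m = ρ g m := fun _ => rfl
  set A : AddSubgroup M := ((ρ τ : M →ₗ[ℤ] M).toAddMonoidHom - AddMonoidHom.id M).range with hA
  set B : AddSubgroup M := ((ρ' φ : M →ₗ[ℤ] M).toAddMonoidHom - AddMonoidHom.id M).range with hB
  have hAB : A.map e.toAddMonoidHom = B := by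
    ext m
    simp only [AddSubgroup.mem_map, hA, hB, AddMonoidHom.mem_range, AddMonoidHom.sub_apply,
      LinearMap.toAddMonoidHom_coe, AddMonoidHom.id_apply]
    constructor
    · rintro ⟨x, ⟨y, rfl⟩, rfl⟩
      refine ⟨ρ g y, ?_⟩
      change _ = e (ρ τ y - y)
      rw [h, Module.End.mul_apply, Module.End.mul_apply, hgi, map_sub, he, he]
    · rintro ⟨y, rfl⟩
      refine ⟨ρ τ (ρ g⁻¹ y) - ρ g⁻¹ y, ⟨ρ g⁻¹ y, rfl⟩, ?_⟩
      change e (ρ τ (ρ g⁻¹ y) - ρ g⁻¹ y) = _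
      rw [map_sub, he, he, hig, h, Module.End.mul_apply, Module.End.mul_apply]
  exact ⟨(QuotientAddGroup.congr A B e hAB).symm.trans eτ⟩

end Conj

/-! ### §2 Admissibility at Sakamoto's primes over `ℚ` -/

section Rat

variable {M : Type} [AddCommGroup M] [TopologicalSpace M] [DiscreteTopology M]
variable (ρ : DiscreteGaloisModule ℚ M) (p : ℕ) [Fact p.Prime] [Module (ZMod p) M]
  [Module.Free (ZMod p) M] [Module.Finite (ZMod p) M]

/-- Kim's primitive root read through the LOCAL mod-`ℓ` cyclotomic character: the tree's
`localNormCyclotomicCharacter q` (global character restricted along `Γ_{ℚ_q} → Γ_ℚ`) is the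
mod-`ℓ` cyclotomic character of `ℚ_q` itself (`ℓ = N𝔮`), by compatibility with restriction
(`modPCyclotomicCharacterZMod_absGaloisRestrict`). [folklore] -/
theorem localNormCyclotomicCharacter_eq_modPCyclotomicCharacterZMod (q : HeightOneSpectrum (𝓞 ℚ))
    [Fact (Ideal.absNorm q.asIdeal).Prime] [NeZero ((Ideal.absNorm q.asIdeal : ℕ) : q.adicCompletion ℚ)]
    (t : absoluteGaloisGroup (q.adicCompletion ℚ)) :
    localNormCyclotomicCharacter q t =
      modPCyclotomicCharacterZMod (q.adicCompletion ℚ) (Ideal.absNorm q.asIdeal) t := by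
  rw [localNormCyclotomicCharacter_apply, ← modPCyclotomicCharacterZMod_eq_modNCyclotomicCharacter,
    modPCyclotomicCharacterZMod_absGaloisRestrict]

/-- **[MR04] Lemma 1.2.3 / Rubin PCMI Ex. 1.9.7 — the canonical Kolyvagin datum is ADMISSIBLE.**
For `T` free of finite rank over `𝔽_p` with a discrete `Γ_ℚ`-action, `τ ∈ Gal(ℚ̄/ℚ(μ_p))` with
`T/(τ − 1)T ≅ ℤ/p`, and a Kolyvagin datum `D` with `D.primes = frobeniusClassPrimes ρ S τ p` whose
comparison maps are the canonical ones (`D.HasCanonicalComparison p η`): at every `𝔮 ∈ 𝒫(τ)` the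
map `φ^{fs}_𝔮 : H¹_ur(ℚ_𝔮, T) → H¹(ℚ_𝔮, T)/H¹_ur` is a bijection, i.e. `D.IsAdmissible`.
Injective by file 3 (`Q(Fr⁻¹)` injective on `T/(Fr − 1)T`, evaluation at Frobenius injective on
`H¹_ur`); surjective by counting (`#H¹_ur = p = #H¹_tr`, `H¹_ur + H¹_tr = H¹`, n1011-p18).
[cite: MazurRubin2004, Lemma 1.2.3 (p. 10–11)] [cite: Rubin2011, Exercise 1.9.7 (p. 15)]
[cite: Sakamoto2024, §4 (p. 925), the finite-singular comparison isomorphism] -/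
theorem isAdmissible_of_hasCanonicalComparison_frobeniusClassPrimes
    (S : Set (HeightOneSpectrum (𝓞 ℚ))) {τ : absoluteGaloisGroup ℚ}
    (hτq : Nonempty (cokerSubOne ρ τ ≃+ ZMod p)) (hτμ : τ ∈ rootsOfUnityFixer ℚ p)
    {D : KolyvaginDatum ρ} (hP : D.primes = frobeniusClassPrimes ρ S τ p)
    {η : (q : HeightOneSpectrum (𝓞 ℚ)) → (ZMod (Ideal.absNorm q.asIdeal))ˣ}
    (hD : D.HasCanonicalComparison p η) : D.IsAdmissible := by
  classical
  have hp : p.Prime := Fact.out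
  haveI : NeZero p := ⟨hp.ne_zero⟩
  haveI : Finite M := Module.finite_of_finite (ZMod p)
  intro q hq
  have hq' : q ∈ frobeniusClassPrimes ρ S τ p := hP ▸ hq
  haveI : Fact (Ideal.absNorm q.asIdeal).Prime := ⟨prime_absNorm_rat q⟩
  haveI : CharZero (q.adicCompletion ℚ) :=
    charZero_of_injective_algebraMap (algebraMap ℚ (q.adicCompletion ℚ)).injective
  haveI : NeZero ((Ideal.absNorm q.asIdeal : ℕ) : q.adicCompletion ℚ) :=
    ⟨Nat.cast_ne_zero.2 (Fact.out : (Ideal.absNorm q.asIdeal).Prime).ne_zero⟩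
  -- the local module is unramified
  have hI : ∀ t ∈ absInertia (q.adicCompletion ℚ), GaloisRep.toLocal q ρ t = 1 := fun t ht =>
    (GaloisRep.isUnramifiedAt_iff_toLocal_holds q ρ).1 hq'.2.2.1 t ht
  -- a local arithmetic Frobenius, acting as a conjugate of `τ`: `T/(Fr − 1)T ≃ ℤ/p`
  obtain ⟨φ, hφ⟩ := exists_isAbsArithFrob_holds (F := q.adicCompletion ℚ)
  obtain ⟨g, hg⟩ := exists_toLocal_eq_conj ρ p S τ hq' hφ
  have hcok : Nonempty (cokerSubOne (GaloisRep.toLocal q ρ) φ ≃+ ZMod p) :=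
    nonempty_cokerSubOne_equiv_of_eq_conj ρ (GaloisRep.toLocal q ρ) hg hτq
  -- an inertia element over Kim's primitive root `η_𝔮`
  obtain ⟨t, ht, hχt⟩ := modPCyclotomicCharacter_surjOn_absInertia_rat_holds q (η q)
  have hη : localNormCyclotomicCharacter q t = η q := by
    rw [localNormCyclotomicCharacter_eq_modPCyclotomicCharacterZMod]; exact hχt
  -- the canonical comparison map at `(φ, t)`, hence injective on `H¹_ur`
  have hinj := injective_fs_of_isFiniteSingularComparisonWith (GaloisRep.toLocal q ρ) p hI hφ hcok
    (hD.at hq hφ ht hη)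
  refine ⟨hinj, ?_⟩
  -- counting: `#H¹_ur = p`, `#H¹_tr = p`, `H¹_ur ⊔ H¹_tr = ⊤`
  have hMN : ∀ m : M, p • m = 0 := fun m => by
    rw [← Nat.cast_smul_eq_nsmul (ZMod p), ZMod.natCast_self, zero_smul]
  have hM : ∀ m : M, (Ideal.absNorm q.asIdeal - 1) • m = 0 :=
    absNorm_sub_one_smul_eq_zero_of_mem_frobeniusClassPrimes ρ hq' hτμ hMN
  have hU : Nat.card (unramifiedSubgroup (GaloisRep.toLocal q ρ) 1) = p :=
    natCard_unramifiedSubgroup_toLocal_of_mem_frobeniusClassPrimes ρ hq' hτq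
  have hT : Nat.card (cyclotomicTransverse ρ (Sum.inr q)) = p :=
    natCard_cyclotomicTransverse_rat_of_mem_frobeniusClassPrimes' ρ hq' hτq hM
  have hUT := unramifiedSubgroup_sup_cyclotomicTransverse_eq_top_of_mem_frobeniusClassPrimes ρ hq'
    hM (modPCyclotomicCharacter_surjOn_absInertia_rat_holds q)
  set U := unramifiedSubgroup (GaloisRep.toLocal q ρ) 1 with hUdef
  haveI : Finite (cyclotomicTransverse ρ (Sum.inr q)) :=
    Nat.finite_of_card_ne_zero (by rw [hT]; exact hp.ne_zero)
  haveI : Finite U := Nat.finite_of_card_ne_zero (by rw [hU]; exact hp.ne_zero)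
  -- `H¹_tr → H¹/H¹_ur` is onto
  let π : cyclotomicTransverse ρ (Sum.inr q) → SingularQuotient (GaloisRep.toLocal q ρ) :=
    fun y => singularMap (GaloisRep.toLocal q ρ) y.1
  have hπ : Function.Surjective π := by
    intro c
    obtain ⟨x, rfl⟩ := QuotientAddGroup.mk_surjective c
    have hx : x ∈ U ⊔ cyclotomicTransverse ρ (Sum.inr q) := by rw [hUT]; exact AddSubgroup.mem_top x
    obtain ⟨u, hu, y, hy, rfl⟩ := AddSubgroup.mem_sup.mp hx
    refine ⟨⟨y, hy⟩, ?_⟩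
    show singularMap (GaloisRep.toLocal q ρ) y = QuotientAddGroup.mk (u + y)
    rw [QuotientAddGroup.mk_add, (QuotientAddGroup.eq_zero_iff u).mpr hu, zero_add]
    rfl
  haveI : Finite (SingularQuotient (GaloisRep.toLocal q ρ)) := Finite.of_surjective π hπ
  have hle : Nat.card (SingularQuotient (GaloisRep.toLocal q ρ)) ≤ p := by
    rw [← hT]; exact Nat.card_le_card_of_surjective π hπ
  have hge : p ≤ Nat.card (SingularQuotient (GaloisRep.toLocal q ρ)) := by
    rw [← hU]; exact Nat.card_le_card_of_injective _ hinj
  have hcard : Nat.card U = Nat.card (SingularQuotient (GaloisRep.toLocal q ρ)) := by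
    rw [hU]; exact le_antisymm hge hle
  exact ((Nat.bijective_iff_injective_and_card _).mpr ⟨hinj, hcard⟩).2

/-- **Existence with admissibility**: over `ℚ`, for `T` free of finite rank over `𝔽_p`,
`τ ∈ Gal(ℚ̄/ℚ(μ_p))` with `T/(τ − 1)T ≅ ℤ/p`, any `S`, any transverse conditions `𝒯` and
primitive roots `η_ℓ` at the primes of `𝒫(τ)`, there is a Kolyvagin datum with
`D.primes = frobeniusClassPrimes ρ S τ p`, `D.transverse = 𝒯`, THE canonical comparison maps
(n1011-p04) AND `D.IsAdmissible`. [cite: MazurRubin2004, Def. 1.2.2 and Lemma 1.2.3 (p. 10–11)]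
[cite: Rubin2011, Def. 1.9.6 and Exercise 1.9.7 (pp. 14–15)] -/
theorem exists_kolyvaginDatum_isAdmissible_frobeniusClassPrimes
    (S : Set (HeightOneSpectrum (𝓞 ℚ))) {τ : absoluteGaloisGroup ℚ}
    (hτμ : τ ∈ rootsOfUnityFixer ℚ p) (hτq : Nonempty (cokerSubOne ρ τ ≃+ ZMod p))
    (T : SelmerStructure ρ) (η : (q : HeightOneSpectrum (𝓞 ℚ)) → (ZMod (Ideal.absNorm q.asIdeal))ˣ)
    (hη : ∀ q ∈ frobeniusClassPrimes ρ S τ p, Subgroup.zpowers (η q) = ⊤) :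
    ∃ D : KolyvaginDatum ρ, D.primes = frobeniusClassPrimes ρ S τ p ∧ D.transverse = T ∧
      D.HasCanonicalComparison p η ∧ D.IsAdmissible := by
  haveI : NeZero p := ⟨(Fact.out : p.Prime).ne_zero⟩
  obtain ⟨D, hP, hT, hD⟩ :=
    exists_kolyvaginDatum_hasCanonicalComparison_frobeniusClassPrimes ρ p S hτμ hτq T η hη
  exact ⟨D, hP, hT, hD, isAdmissible_of_hasCanonicalComparison_frobeniusClassPrimes ρ p S hτq hτμ hP hD⟩

/-- **Primitive roots included** (`(ℤ/ℓ)ˣ` is cyclic): `∃ η D`, canonical AND admissible.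
[cite: MazurRubin2004, Lemma 1.2.3 (p. 10–11)] -/
theorem exists_eta_kolyvaginDatum_isAdmissible_frobeniusClassPrimes
    (S : Set (HeightOneSpectrum (𝓞 ℚ))) {τ : absoluteGaloisGroup ℚ}
    (hτμ : τ ∈ rootsOfUnityFixer ℚ p) (hτq : Nonempty (cokerSubOne ρ τ ≃+ ZMod p))
    (T : SelmerStructure ρ) :
    ∃ (η : (q : HeightOneSpectrum (𝓞 ℚ)) → (ZMod (Ideal.absNorm q.asIdeal))ˣ) (D : KolyvaginDatum ρ),
      D.primes = frobeniusClassPrimes ρ S τ p ∧ D.transverse = T ∧ D.HasCanonicalComparison p η ∧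
        D.IsAdmissible := by
  haveI : NeZero p := ⟨(Fact.out : p.Prime).ne_zero⟩
  obtain ⟨η, D, hP, hT, hD⟩ :=
    exists_eta_kolyvaginDatum_hasCanonicalComparison_frobeniusClassPrimes ρ p S hτμ hτq T
  exact ⟨η, D, hP, hT, hD,
    isAdmissible_of_hasCanonicalComparison_frobeniusClassPrimes ρ p S hτq hτμ hP hD⟩

end Rat

end Summit.BirchSwinnertonDyer.Rank1Residual.GaloisImage.FSComp

end
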